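import Summits.CriticalPhenomena.PercolationContinuityZ3.Theses.PercNonProliferation
import Summits.CriticalPhenomena.PercolationContinuityZ3.Theorems.FreeBoxPowerSaving.Negative.FreeBoxPowerSavingBounds
import Literature.Probability.Percolation.SharpnessDCTProofs
import Literature.Probability.Percolation.CriticalContinuityProofs

/-!
# Negative lemmas on the stub set of line `tightness-collapse-typical-kmax`
# (crux `PercNonProliferation.FreeBoxPowerSaving`, stmt-CriticalPhenomena-4447)

Drefute findings (refuter seat `refuter-drefute-stmt-CriticalPhenomena-4447-0`, 2026-08-16), all
sorry-free.  The four stubs of `Cruxes/FreeBoxPowerSaving/Lines/tightness-collapse-typical-kmax.lean`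
are quoted through the local vocabulary of that file (`pieceIn`, `quasiGiant`, `glued`), which
unfolds DEFINITIONALLY to the registered def-free texts (the skeleton's `sig_*_iff := Iff.rfl`).

* `measurableSet_le_card_pieceIn`, `measurableSet_quasiGiant` — the quasi-giant event
  `QG(n,s) = {∃ u ∈ B(n), #C_n(u) ≥ s}` is measurable (helper the provers of `stub_sizeSplitting` /
  `stub_logBoost` need; proved by rewriting `{s ≤ #C_n(u)}` as a finite union over vertex sets).
* LOAD-BEARING HYPOTHESES (each theorem is `¬ <stub with one hypothesis dropped>`):
  - `gluingCriterion_false_without_one_le` — drop `1 ≤ n` from `stub_gluingCriterion`: FALSE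
    (`n = 0`: both boxes are `{0}`, the good event is sure for `s ≤ 1`, and `θ(0) = 0`).
  - `gluingCriterion_false_without_glued` — drop the gluing clause: FALSE (`s = 0`: `QG` is sure).
  - `gluingCriterion_false_without_quasiGiant` — drop the quasi-giant clause: FALSE
    (`s = 28 > |B(1)|`: `Glued(1,28)` is vacuously sure).
  - `logBoost_false_without_pos_exponent` — drop `0 < a` from `stub_logBoost`: FALSE (`p = 1`,
    `a = -2`: `QG(n, n⁵) = ∅` eventually, so the one-bit hypothesis holds with `ε = 1`, while
    `FA₂(1, n) = 1` has no power saving, `FreeBoxPowerSavingNegative.false_at_one`).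
* `sizeSplitting_at_one` — the size-splitting inequality at `p = 1` (used above; Dirac mass at `E(ℤ³)`).
* Companion file `TightnessCollapseNoFoamOfCrux.lean`: the crux IMPLIES `stub_noCriticalFoam`.
-/

noncomputable section

open MeasureTheory Filter
open Literature.Probability.Percolation Literature.Probability.LatticeModels
open Summit.CriticalPhenomena.PercolationContinuityZ3.FreeBoxPowerSavingNegative (fa2 pairSum
  of_eventually false_at_one bondPercolation_one openConnIn_self_eq_univ edgeSet_mem_openConnIn_box
  freeBoxPowerSaving_iff_fa2 fa2_nonneg card_box_pos card_box_real)
open scoped Topology Classical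

namespace Summit.CriticalPhenomena.PercolationContinuityZ3.FreeBoxPowerSavingNegative.TightnessCollapse

/-! ## Vocabulary (verbatim from the skeleton, §0) -/

/-- `P_p` = bond percolation on `ℤ³`. [folklore] -/
abbrev μ (p : unitInterval) : Measure (BondConfig (Site 3)) := bondPercolation (zdGraph 3) p

/-- `C_m(u)(ω)`: the piece of `u` in the open subgraph induced on the free box `B(m)`. [folklore] -/
def pieceIn (m : ℕ) (u : Site 3) (ω : BondConfig (Site 3)) : Finset (Site 3) :=
  (box 3 m).filter fun v => ω ∈ openConnIn ↑(box 3 m) u v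

/-- `QG(n,s)`: some piece of the free box `B(n)` has at least `s` vertices. [folklore] -/
def quasiGiant (n : ℕ) (s : ℝ) : Set (BondConfig (Site 3)) :=
  {ω | ∃ u ∈ box 3 n, s ≤ ((pieceIn n u ω).card : ℝ)}

/-- `Glued(n,s)`: every `s`-fat vertex of `B(n)` is joined inside `B(2n)` to every `s`-fat vertex
of `B(2n)`. [folklore] -/
def glued (n : ℕ) (s : ℝ) : Set (BondConfig (Site 3)) :=
  {ω | ∀ u ∈ box 3 n, ∀ u' ∈ box 3 (2 * n), s ≤ ((pieceIn n u ω).card : ℝ) →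
    s ≤ ((pieceIn (2 * n) u' ω).card : ℝ) → ω ∈ openConnIn ↑(box 3 (2 * n)) u u'}

/-! ## Measurability of the quasi-giant event -/

/-- `{s ≤ #C_n(u)}` as a finite union of finite intersections of box connections. [folklore] -/
theorem setOf_le_card_pieceIn_eq (n : ℕ) (u : Site 3) (s : ℝ) :
    {ω | s ≤ ((pieceIn n u ω).card : ℝ)} =
      ⋃ T ∈ (box 3 n).powerset.filter (fun T => s ≤ (T.card : ℝ)),
        ⋂ v ∈ T, openConnIn (↑(box 3 n) : Set (Site 3)) u v := by
  ext ω
  simp only [Set.mem_setOf_eq, Set.mem_iUnion, Set.mem_iInter, Finset.mem_filter,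
    Finset.mem_powerset, exists_prop]
  constructor
  · intro h
    refine ⟨pieceIn n u ω, ⟨Finset.filter_subset _ _, h⟩, fun v hv => ?_⟩
    exact (Finset.mem_filter.1 hv).2
  · rintro ⟨T, ⟨hT, hsT⟩, hconn⟩
    have hsub : T ⊆ pieceIn n u ω := fun v hv => Finset.mem_filter.2 ⟨hT hv, hconn v hv⟩
    exact hsT.trans (by exact_mod_cast Finset.card_le_card hsub)

/-- `{s ≤ #C_n(u)}` is measurable. [folklore] -/
theorem measurableSet_le_card_pieceIn (n : ℕ) (u : Site 3) (s : ℝ) :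
    MeasurableSet {ω : BondConfig (Site 3) | s ≤ ((pieceIn n u ω).card : ℝ)} := by
  rw [setOf_le_card_pieceIn_eq]
  refine MeasurableSet.biUnion (Finset.countable_toSet _) fun T _ => ?_
  exact MeasurableSet.biInter (Finset.countable_toSet _) fun v _ =>
    DCT16.measurableSet_openConnIn (box 3 n) u v

/-- **The quasi-giant event `QG(n,s)` is measurable.** [folklore] -/
theorem measurableSet_quasiGiant (n : ℕ) (s : ℝ) : MeasurableSet (quasiGiant n s) := by
  have : quasiGiant n s = ⋃ u ∈ box 3 n, {ω | s ≤ ((pieceIn n u ω).card : ℝ)} := by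
    ext ω; simp [quasiGiant]
  rw [this]
  exact MeasurableSet.biUnion (Finset.countable_toSet _) fun u _ =>
    measurableSet_le_card_pieceIn n u s

/-! ## Small facts -/

/-- `θ(0) = 0` on `ℤ³` (`0 < p_c(ℤ³)`). [folklore] -/
theorem theta_zero : theta (zdGraph 3) (0 : Site 3) 0 = 0 :=
  theta_eq_zero_of_lt_criticalProb_holds (zdGraph 3) (0 : Site 3) 0
    (by simpa using criticalProb_zd_pos 3 (by norm_num))

/-- The only point of `B(0)` is the origin. [folklore] -/
theorem eq_zero_of_mem_box_zero {u : Site 3} (hu : u ∈ box 3 0) : u = 0 := by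
  rw [mem_box] at hu
  funext i
  have := hu i
  simp only [Nat.cast_zero, neg_zero] at this
  exact le_antisymm this.2 this.1

/-- A piece of `B(m)` has at most `|B(m)|` vertices. [folklore] -/
theorem card_pieceIn_le (m : ℕ) (u : Site 3) (ω : BondConfig (Site 3)) :
    (pieceIn m u ω).card ≤ (2 * m + 1) ^ 3 := by
  rw [← card_box 3 m]; exact Finset.card_filter_le _ _

/-- `QG(n, 0)` is the sure event. [folklore] -/
theorem quasiGiant_zero (n : ℕ) : quasiGiant n 0 = Set.univ :=
  Set.eq_univ_of_forall fun _ => ⟨0, zero_mem_box 3 n, Nat.cast_nonneg _⟩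

/-! ## `stub_gluingCriterion`: the three hypotheses are load-bearing -/

/-- **Dropping `1 ≤ n` from `stub_gluingCriterion` makes it FALSE.**  Witness `p = 0`, `n = 0`,
`s = 0`: `B(0) = B(2·0) = {0}`, so `QG(0,0) ∩ Glued(0,0)` is the sure event (the origin is joined
to itself), its probability `1` exceeds `1 - ε₀`, yet `θ(0) = 0`. [folklore] -/
theorem gluingCriterion_false_without_one_le :
    ¬ ∃ ε₀ : ℝ, 0 < ε₀ ∧ ∀ (p : unitInterval) (n : ℕ) (s : ℝ),
      1 - ε₀ < (μ p).real (quasiGiant n s ∩ glued n s) → 0 < theta (zdGraph 3) (0 : Site 3) p := by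
  rintro ⟨ε₀, hε₀, h⟩
  have huniv : quasiGiant 0 0 ∩ glued 0 0 = Set.univ := by
    refine Set.eq_univ_of_forall fun ω => ⟨⟨0, zero_mem_box 3 0, Nat.cast_nonneg _⟩, ?_⟩
    intro u hu u' hu' _ _
    have hu0 : u = 0 := eq_zero_of_mem_box_zero hu
    have hu'b : u' ∈ box 3 0 := by rw [Nat.mul_zero] at hu'; exact hu'
    have hu'0 : u' = 0 := eq_zero_of_mem_box_zero hu'b
    subst hu0; subst hu'0
    rw [show (2 * 0 : ℕ) = 0 from rfl, openConnIn_self_eq_univ hu'b]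
    trivial
  have h1 := h 0 0 0 (by rw [huniv, probReal_univ]; linarith)
  rw [theta_zero] at h1
  exact lt_irrefl _ h1

/-- **Dropping the gluing clause from `stub_gluingCriterion` makes it FALSE.**  Witness `p = 0`,
`n = 1`, `s = 0`: `QG(1, 0)` is sure, yet `θ(0) = 0`. [folklore] -/
theorem gluingCriterion_false_without_glued :
    ¬ ∃ ε₀ : ℝ, 0 < ε₀ ∧ ∀ (p : unitInterval) (n : ℕ), 1 ≤ n → ∀ s : ℝ,
      1 - ε₀ < (μ p).real (quasiGiant n s) → 0 < theta (zdGraph 3) (0 : Site 3) p := by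
  rintro ⟨ε₀, hε₀, h⟩
  have h1 := h 0 1 le_rfl 0 (by rw [quasiGiant_zero, probReal_univ]; linarith)
  rw [theta_zero] at h1
  exact lt_irrefl _ h1

/-- **Dropping the quasi-giant clause from `stub_gluingCriterion` makes it FALSE.**  Witness
`p = 0`, `n = 1`, `s = 28 > 27 = |B(1)|`: no vertex of `B(1)` is `28`-fat, so `Glued(1, 28)` is
vacuously sure, yet `θ(0) = 0`. [folklore] -/
theorem gluingCriterion_false_without_quasiGiant :
    ¬ ∃ ε₀ : ℝ, 0 < ε₀ ∧ ∀ (p : unitInterval) (n : ℕ), 1 ≤ n → ∀ s : ℝ,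
      1 - ε₀ < (μ p).real (glued n s) → 0 < theta (zdGraph 3) (0 : Site 3) p := by
  rintro ⟨ε₀, hε₀, h⟩
  have huniv : glued 1 28 = Set.univ := by
    refine Set.eq_univ_of_forall fun ω => ?_
    intro u _ u' _ hfat _
    exfalso
    have hle : ((pieceIn 1 u ω).card : ℝ) ≤ 27 := by
      have := card_pieceIn_le 1 u ω
      norm_num at this
      exact_mod_cast this
    linarith
  have h1 := h 0 1 le_rfl 28 (by rw [huniv, probReal_univ]; linarith)
  rw [theta_zero] at h1
  exact lt_irrefl _ h1

/-! ## `stub_logBoost`: the hypothesis `0 < a` is load-bearing -/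

/-- At `p = 1`, `P_1(A) = 1_{E(ℤ³) ∈ A}` for measurable `A`. [folklore] -/
theorem real_one_eq_indicator {A : Set (BondConfig (Site 3))} (hA : MeasurableSet A) :
    (μ 1).real A = A.indicator 1 (zdGraph 3).edgeSet := by
  rw [show μ 1 = Measure.dirac (zdGraph 3).edgeSet from bondPercolation_one, measureReal_def,
    Measure.dirac_apply' _ hA]
  by_cases h : (zdGraph 3).edgeSet ∈ A
  · simp [Set.indicator_of_mem h]
  · simp [Set.indicator_of_notMem h]

/-- **Size splitting at `p = 1`** (the Dirac mass at `E(ℤ³)`: both sides are `0/1`-valued and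
`QG(n,3s) ⊆ QG(n,s)`). [folklore] -/
theorem sizeSplitting_at_one (n : ℕ) (s : ℝ) (hs : 1 ≤ s) :
    (μ 1).real (quasiGiant n (3 * s)) ≤ ((μ 1).real (quasiGiant n s)) ^ 2 := by
  by_cases hmem : (zdGraph 3).edgeSet ∈ quasiGiant n (3 * s)
  · have hmem' : (zdGraph 3).edgeSet ∈ quasiGiant n s := by
      obtain ⟨u, hu, h3⟩ := hmem
      exact ⟨u, hu, by linarith⟩
    rw [real_one_eq_indicator (measurableSet_quasiGiant n s), Set.indicator_of_mem hmem']
    simp only [Pi.one_apply, one_pow]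
    exact measureReal_le_one
  · rw [real_one_eq_indicator (measurableSet_quasiGiant n (3 * s)), Set.indicator_of_notMem hmem]
    positivity

/-- For `n ≥ 6`, `QG(n, n⁵) = ∅`: no piece of `B(n)` has `n⁵ > (2n+1)³` vertices. [folklore] -/
theorem quasiGiant_rpow_five_eq_empty {n : ℕ} (hn : 6 ≤ n) :
    quasiGiant n ((n : ℝ) ^ (3 - (-2 : ℝ))) = ∅ := by
  rw [Set.eq_empty_iff_forall_notMem]
  rintro ω ⟨u, _, hfat⟩
  have h5 : (n : ℝ) ^ (3 - (-2 : ℝ)) = (n : ℝ) ^ (5 : ℕ) := by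
    rw [← Real.rpow_natCast]; norm_num
  rw [h5] at hfat
  have hcard : ((pieceIn n u ω).card : ℝ) ≤ (2 * (n : ℝ) + 1) ^ 3 := by
    exact_mod_cast card_pieceIn_le n u ω
  have hn' : (6 : ℝ) ≤ n := by exact_mod_cast hn
  have hlt : (2 * (n : ℝ) + 1) ^ 3 < (n : ℝ) ^ (5 : ℕ) := by
    have h3 : (2 * (n : ℝ) + 1) ^ 3 ≤ (3 * (n : ℝ)) ^ 3 := by
      exact pow_le_pow_left₀ (by positivity) (by linarith) 3
    have h4 : (3 * (n : ℝ)) ^ 3 < (n : ℝ) ^ (5 : ℕ) := by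
      have : (27 : ℝ) < (n : ℝ) ^ 2 := by nlinarith
      calc (3 * (n : ℝ)) ^ 3 = 27 * (n : ℝ) ^ 3 := by ring
        _ < (n : ℝ) ^ 2 * (n : ℝ) ^ 3 := by
            apply mul_lt_mul_of_pos_right this; positivity
        _ = (n : ℝ) ^ (5 : ℕ) := by ring
    exact h3.trans_lt h4
  linarith

/-- **Dropping `0 < a` from `stub_logBoost` makes it FALSE.**  Witness `p = 1`, `a = -2`, `ε = 1`:
size splitting holds at `p = 1` (`sizeSplitting_at_one`), the one-bit hypothesis
`P_1(QG(n, n^{3-a})) ≤ 1 - ε = 0` holds for `n ≥ 6` (`QG(n, n⁵) = ∅`), but the conclusion is an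
eventual power saving for `FA₂(1, ·) ≡ 1`, impossible (`FreeBoxPowerSavingNegative.false_at_one`,
via `of_eventually`).  So a proof of `stub_logBoost` must use `0 < a` (it is what makes
`n^{3-a} ≤ |B(n)|`-type thresholds non-vacuous and the hypothesis informative). [folklore] -/
theorem logBoost_false_without_pos_exponent :
    ¬ ∀ (p : unitInterval),
      (∀ (n : ℕ) (s : ℝ), 1 ≤ s →
        (μ p).real (quasiGiant n (3 * s)) ≤ ((μ p).real (quasiGiant n s)) ^ 2) →
      ∀ (a ε : ℝ), 0 < ε →
        (∀ᶠ n : ℕ in atTop, (μ p).real (quasiGiant n ((n : ℝ) ^ (3 - a))) ≤ 1 - ε) →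
        ∃ a' C : ℝ, 0 < a' ∧ ∀ᶠ n : ℕ in atTop, fa2 p n ≤ C * (n : ℝ) ^ (-a') := by
  intro h
  have hyp : ∀ᶠ n : ℕ in atTop, (μ 1).real (quasiGiant n ((n : ℝ) ^ (3 - (-2 : ℝ)))) ≤ 1 - 1 := by
    rw [eventually_atTop]
    refine ⟨6, fun n hn => ?_⟩
    rw [quasiGiant_rpow_five_eq_empty hn, measureReal_empty]
    norm_num
  obtain ⟨a', C, ha', hev⟩ := h 1 sizeSplitting_at_one (-2) 1 one_pos hyp
  obtain ⟨C', hC'⟩ := of_eventually ha' hev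
  exact false_at_one ⟨a', C', ha', hC'⟩

/-! ## Def-free forms (the registered stub texts with the hypothesis dropped), by `Iff.rfl` -/

/-- `gluingCriterion_false_without_one_le`, def-free. [folklore] -/
theorem gluingCriterion_false_without_one_le' :
    ¬ ∃ ε₀ : ℝ, 0 < ε₀ ∧ ∀ (p : unitInterval) (n : ℕ), ∀ s : ℝ,
      1 - ε₀ < (bondPercolation (zdGraph 3) p).real
        ({ω | ∃ u ∈ box 3 n,
            s ≤ (((box 3 n).filter fun v => ω ∈ openConnIn ↑(box 3 n) u v).card : ℝ)} ∩
         {ω | ∀ u ∈ box 3 n, ∀ u' ∈ box 3 (2 * n),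
            s ≤ (((box 3 n).filter fun v => ω ∈ openConnIn ↑(box 3 n) u v).card : ℝ) →
            s ≤ (((box 3 (2 * n)).filter fun v => ω ∈ openConnIn ↑(box 3 (2 * n)) u' v).card : ℝ) →
            ω ∈ openConnIn ↑(box 3 (2 * n)) u u'}) →
      0 < theta (zdGraph 3) (0 : Site 3) p :=
  gluingCriterion_false_without_one_le

/-- `logBoost_false_without_pos_exponent`, def-free. [folklore] -/
theorem logBoost_false_without_pos_exponent' :
    ¬ ∀ (p : unitInterval),
      (∀ (n : ℕ) (s : ℝ), 1 ≤ s →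
        (bondPercolation (zdGraph 3) p).real
            {ω | ∃ u ∈ box 3 n,
              3 * s ≤ (((box 3 n).filter fun v => ω ∈ openConnIn ↑(box 3 n) u v).card : ℝ)}
          ≤ ((bondPercolation (zdGraph 3) p).real
              {ω | ∃ u ∈ box 3 n,
                s ≤ (((box 3 n).filter fun v => ω ∈ openConnIn ↑(box 3 n) u v).card : ℝ)}) ^ 2) →
      ∀ (a ε : ℝ), 0 < ε →
        (∀ᶠ n : ℕ in atTop,
          (bondPercolation (zdGraph 3) p).real
              {ω | ∃ u ∈ box 3 n,
                (n : ℝ) ^ (3 - a) ≤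
                  (((box 3 n).filter fun v => ω ∈ openConnIn ↑(box 3 n) u v).card : ℝ)}
            ≤ 1 - ε) →
        ∃ a' C : ℝ, 0 < a' ∧ ∀ᶠ n : ℕ in atTop,
          (∑ x ∈ box 3 n, ∑ y ∈ box 3 n,
              (bondPercolation (zdGraph 3) p).real (openConnIn ↑(box 3 n) x y))
            / ((box 3 n).card : ℝ) ^ 2 ≤ C * (n : ℝ) ^ (-a') :=
  logBoost_false_without_pos_exponent

end Summit.CriticalPhenomena.PercolationContinuityZ3.FreeBoxPowerSavingNegative.TightnessCollapse

end
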